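import Literature.Analysis.InnerProduct.CompactEmbeddingKyFanTwo
import Mathlib.Analysis.InnerProductSpace.ProdL2
import Mathlib.Analysis.Normed.Operator.Compact.Basic
import HarnessLib

/-!
# Graph renorming of a compactly embedded Hilbert space (bounded perturbations of a closed form)

Topic `Literature/Analysis/InnerProduct`, sequel of `CompactEmbeddingKyFanTwo.lean`. There a densely
defined closed form `q ≥ -c` on a Hilbert space `H` is encoded as a Hilbert space `Q` with a bounded map
`ι : Q →L[𝕜] H` (`‖ψ‖²_Q = q(ψ) + c‖ιψ‖²`), and the two lowest form eigenvalues are read off the two top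
eigenpairs of the Gram operator `ι†ι` (`TwoModeData ι`) when `ι` is compact.

This file treats the **perturbed form** `q + ‖G·‖²` for a bounded linear map `G : Q →L[𝕜] H'` into an
auxiliary Hilbert space (a non-negative bounded — hence infinitesimally form-bounded — perturbation,
[Kato1966, Ch. VI §1.6, Thm. VI.1.33; ReedSimonIV1978, Thm. XIII.68]). Its form domain is `Q` with the
EQUIVALENT Hilbert norm `‖ψ‖²_Q + ‖Gψ‖²`, which we realise concretely, so that all instances are inherited,
as the **graph** of `G`:

* `graphSpace G` — the closed subspace `{(ψ, Gψ)}` of the Hilbert space `WithLp 2 (Q × H')`, a Hilbert space;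
* `toGraph G : Q →L[𝕜] graphSpace G`, `ψ ↦ (ψ, Gψ)`, a bijection with `‖toGraph G ψ‖² = ‖ψ‖² + ‖Gψ‖²`
  (`norm_toGraph_sq`) and continuous inverse "first component" (`fst_toGraph`, `toGraph_fst`);
* `graphEmbedding ι G : graphSpace G →L[𝕜] H`, `(ψ, Gψ) ↦ ιψ` — the embedding of the perturbed form; it is
  compact when `ι` is (`isCompactOperator_graphEmbedding`), images of dense subspaces of `Q` are dense
  (`dense_map_toGraph`), and `graphEmbedding ι G ∘ toGraph G = ι` (`graphEmbedding_toGraph`);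
* hence `TwoModeData (graphEmbedding ι G)` exists under the hypotheses of `exists_twoModeData` for `ι`
  (`nonempty_twoModeData_graph`), and its payoffs read, back on `Q`:
  `κ₁⁻¹ ≤ ‖ψ‖² + ‖Gψ‖²` for `‖ιψ‖ = 1` (`TwoModeData.le_norm_sq_add_of_graph`), Ky Fan
  `κ₁⁻¹ + κ₂⁻¹ ≤ (‖ψ₁‖² + ‖Gψ₁‖²) + (‖ψ₂‖² + ‖Gψ₂‖²)` for `ιψ₁ ⊥ ιψ₂` normalised
  (`TwoModeData.kyFan_two_le_of_graph`), and the form-core version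
  `∃ ψ ∈ S, ‖ιψ‖ = 1 ∧ ‖ψ‖² + ‖Gψ‖² < κ₁⁻¹ + ε` (`TwoModeData.exists_lt_of_dense_of_graph`).

Written for the rewarded periodic `N`-boson form `q + s(N - n̂₀)` of
`Literature/MathematicalPhysics/QuantumManyBody/PeriodicRewardedFormSpectrum.lean`.

## References
* [Kato1966] T. Kato, *Perturbation Theory for Linear Operators*, Ch. VI §1.6 (relatively bounded
  perturbations of closed forms), Thm. VI.1.33.
* [ReedSimonIV1978] M. Reed, B. Simon, *Methods of Modern Mathematical Physics IV*, Thm. XIII.64, XIII.68.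
* [ReedSimonI1980] M. Reed, B. Simon, *Methods of Modern Mathematical Physics I*, §VIII.6.
-/

noncomputable section

open scoped InnerProductSpace
open RCLike ContinuousLinearMap Filter Set WithLp
open _root_.Topology

namespace Literature.Analysis.InnerProduct

variable {𝕜 : Type*} [RCLike 𝕜]
variable {Q H H' : Type*} [NormedAddCommGroup Q] [InnerProductSpace 𝕜 Q]
  [NormedAddCommGroup H] [InnerProductSpace 𝕜 H]
  [NormedAddCommGroup H'] [InnerProductSpace 𝕜 H']

/-! ### The graph of a bounded map as a Hilbert space -/

/-- **The graph of `G`** as a subspace of the Hilbert space `Q ⊕₂ H'`: `{x | x.2 = G x.1}`; with the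
induced `L²`-norm `‖(ψ, Gψ)‖² = ‖ψ‖² + ‖Gψ‖²` it is the form domain of the perturbed form `q + ‖G·‖²`.
[cite: Kato1966, Ch. VI §1.6] -/
def graphSpace (G : Q →L[𝕜] H') : Submodule 𝕜 (WithLp 2 (Q × H')) where
  carrier := {x | x.snd = G x.fst}
  zero_mem' := by simp
  add_mem' {x y} hx hy := by
    simp only [Set.mem_setOf_eq] at hx hy ⊢
    rw [WithLp.add_snd, WithLp.add_fst, map_add, hx, hy]
  smul_mem' c x hx := by
    simp only [Set.mem_setOf_eq] at hx ⊢
    rw [WithLp.smul_snd, WithLp.smul_fst, map_smul, hx]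

variable (G : Q →L[𝕜] H')

/-- Membership in the graph. [folklore] -/
theorem mem_graphSpace {x : WithLp 2 (Q × H')} : x ∈ graphSpace G ↔ x.snd = G x.fst := Iff.rfl

/-- The graph of a bounded map is closed. [folklore] -/
theorem isClosed_graphSpace : IsClosed (graphSpace G : Set (WithLp 2 (Q × H'))) := by
  have h : (graphSpace G : Set (WithLp 2 (Q × H'))) = {x | x.snd = G x.fst} := rfl
  rw [h]
  exact isClosed_eq (WithLp.continuous_snd 2 Q H') (G.continuous.comp (WithLp.continuous_fst 2 Q H'))

/-- The graph is complete when `Q` and `H'` are. [folklore] -/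
instance graphSpace.instCompleteSpace [CompleteSpace Q] [CompleteSpace H'] : CompleteSpace (graphSpace G) :=
  (isClosed_graphSpace G).completeSpace_coe

/-- **The graph map** `ψ ↦ (ψ, Gψ)`, a continuous linear bijection `Q → graphSpace G`. [folklore] -/
def toGraph : Q →L[𝕜] graphSpace G :=
  ContinuousLinearMap.codRestrict
    ((WithLp.prodContinuousLinearEquiv 2 𝕜 Q H').symm.toContinuousLinearMap ∘L
      ((ContinuousLinearMap.id 𝕜 Q).prod G))
    (graphSpace G) fun x => by simp [mem_graphSpace]

/-- The underlying pair of `toGraph G ψ` is `(ψ, Gψ)`. [folklore] -/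
theorem coe_toGraph (x : Q) : (toGraph G x : WithLp 2 (Q × H')) = WithLp.toLp 2 (x, G x) := rfl

/-- First component of the graph map. [folklore] -/
@[simp] theorem fst_toGraph (x : Q) : (toGraph G x : WithLp 2 (Q × H')).fst = x := rfl

/-- Second component of the graph map. [folklore] -/
@[simp] theorem snd_toGraph (x : Q) : (toGraph G x : WithLp 2 (Q × H')).snd = G x := rfl

/-- **The graph norm**: `‖(ψ, Gψ)‖² = ‖ψ‖² + ‖Gψ‖²`. [cite: Kato1966, Ch. VI §1.6] -/
theorem norm_toGraph_sq (x : Q) : ‖toGraph G x‖ ^ 2 = ‖x‖ ^ 2 + ‖G x‖ ^ 2 := by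
  rw [Submodule.coe_norm, coe_toGraph, WithLp.prod_norm_sq_eq_of_L2]
  rfl

/-- `‖ψ‖ ≤ ‖(ψ, Gψ)‖`. [folklore] -/
theorem norm_le_norm_toGraph (x : Q) : ‖x‖ ≤ ‖toGraph G x‖ := by
  have h := norm_toGraph_sq G x
  nlinarith [norm_nonneg x, norm_nonneg (toGraph G x), norm_nonneg (G x)]

/-- Every element of the graph is `(ψ, Gψ)` with `ψ` its first component. [folklore] -/
theorem toGraph_fst (y : graphSpace G) : toGraph G ((y : WithLp 2 (Q × H')).fst) = y := by
  apply Subtype.ext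
  rw [coe_toGraph]
  have hy : (y : WithLp 2 (Q × H')).snd = G (y : WithLp 2 (Q × H')).fst := y.2
  rw [← hy]
  rfl

/-- The graph map is surjective. [folklore] -/
theorem toGraph_surjective : Function.Surjective (toGraph G) := fun y => ⟨_, toGraph_fst G y⟩

/-- The graph map is injective. [folklore] -/
theorem toGraph_injective : Function.Injective (toGraph G) := fun x y h => by
  have := congrArg (fun z : graphSpace G => (z : WithLp 2 (Q × H')).fst) h
  simpa using this

/-- The norm of a graph element: `‖y‖² = ‖y.1‖² + ‖G y.1‖²`. [folklore] -/
theorem norm_sq_eq_of_mem_graphSpace (y : graphSpace G) :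
    ‖y‖ ^ 2 = ‖(y : WithLp 2 (Q × H')).fst‖ ^ 2 + ‖G (y : WithLp 2 (Q × H')).fst‖ ^ 2 := by
  conv_lhs => rw [← toGraph_fst G y]
  exact norm_toGraph_sq G _

/-- **Dense subspaces of `Q` have dense image in the graph** (the graph map is a continuous surjection;
a form core of `q` is a form core of `q + ‖G·‖²`). [cite: Kato1966, Thm. VI.1.33] -/
theorem dense_map_toGraph {S : Submodule 𝕜 Q} (hS : Dense (S : Set Q)) :
    Dense ((S.map (toGraph G : Q →ₗ[𝕜] graphSpace G)) : Set (graphSpace G)) := by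
  rw [Submodule.map_coe]
  exact (toGraph_surjective G).denseRange.dense_image (toGraph G).continuous hS

/-- Elements of the image subspace come from `S`. [folklore] -/
theorem exists_eq_toGraph_of_mem_map {S : Submodule 𝕜 Q} {y : graphSpace G}
    (hy : y ∈ S.map (toGraph G : Q →ₗ[𝕜] graphSpace G)) : ∃ x ∈ S, toGraph G x = y := by
  obtain ⟨x, hx, rfl⟩ := Submodule.mem_map.1 hy
  exact ⟨x, hx, rfl⟩

/-! ### The embedding of the perturbed form -/

variable {G}

/-- **The embedding of the perturbed form domain**: `(ψ, Gψ) ↦ ιψ`. [cite: ReedSimonIV1978, Thm. XIII.68] -/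
def graphEmbedding (ι : Q →L[𝕜] H) (G : Q →L[𝕜] H') : graphSpace G →L[𝕜] H :=
  ι ∘L ((WithLp.fstL 2 𝕜 Q H') ∘L (graphSpace G).subtypeL)

variable (ι : Q →L[𝕜] H) (G : Q →L[𝕜] H')

/-- `graphEmbedding ι G y = ι y.1`. [folklore] -/
theorem graphEmbedding_apply (y : graphSpace G) :
    graphEmbedding ι G y = ι ((y : WithLp 2 (Q × H')).fst) := rfl

/-- `graphEmbedding ι G (ψ, Gψ) = ιψ`. [folklore] -/
@[simp] theorem graphEmbedding_toGraph (x : Q) : graphEmbedding ι G (toGraph G x) = ι x := rfl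

/-- **The perturbed embedding is compact when `ι` is** (compact resolvent is stable under bounded
non-negative form perturbations). [cite: ReedSimonIV1978, Thm. XIII.64 and Thm. XIII.68] -/
theorem isCompactOperator_graphEmbedding (hι : IsCompactOperator ι) : IsCompactOperator (graphEmbedding ι G) := by
  have h := hι.comp_clm ((WithLp.fstL 2 𝕜 Q H') ∘L (graphSpace G).subtypeL)
  exact h

/-- Two `H`-orthogonal non-zero images of `ι` are images of the perturbed embedding. [folklore] -/
theorem exists_orthogonal_graphEmbedding (h2 : ∃ x y : Q, ⟪ι x, ι y⟫_𝕜 = 0 ∧ ι x ≠ 0 ∧ ι y ≠ 0) :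
    ∃ x y : graphSpace G, ⟪graphEmbedding ι G x, graphEmbedding ι G y⟫_𝕜 = 0 ∧
      graphEmbedding ι G x ≠ 0 ∧ graphEmbedding ι G y ≠ 0 := by
  obtain ⟨x, y, hxy, hx, hy⟩ := h2
  exact ⟨toGraph G x, toGraph G y, by simpa using hxy, by simpa using hx, by simpa using hy⟩

variable [CompleteSpace Q] [CompleteSpace H] [CompleteSpace H']

/-- **The spectral data of the perturbed form exist** whenever those of `ι` do: compact `ι` and two
non-zero `H`-orthogonal images. [cite: ReedSimonIV1978, Thm. XIII.64] -/
theorem nonempty_twoModeData_graph (hι : IsCompactOperator ι)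
    (h2 : ∃ x y : Q, ⟪ι x, ι y⟫_𝕜 = 0 ∧ ι x ≠ 0 ∧ ι y ≠ 0) :
    Nonempty (TwoModeData (graphEmbedding ι G)) :=
  exists_twoModeData _ (isCompactOperator_graphEmbedding ι G hι) (exists_orthogonal_graphEmbedding ι G h2)

namespace TwoModeData

variable {ι G}
variable (d : TwoModeData (graphEmbedding ι G))

/-- **The lowest eigenvalue of the perturbed form bounds it from below**: `κ₁⁻¹ ≤ ‖ψ‖² + ‖Gψ‖²` whenever
`‖ιψ‖ = 1`. [cite: ReedSimonIV1978, Thm. XIII.1] -/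
theorem le_norm_sq_add_of_graph {ψ : Q} (hψ : ‖ι ψ‖ = 1) : d.κ₁⁻¹ ≤ ‖ψ‖ ^ 2 + ‖G ψ‖ ^ 2 := by
  rw [← norm_toGraph_sq]
  exact d.le_norm_sq (by simpa using hψ)

/-- **Ky Fan for the perturbed form (`m = 2`)**: for `ιψ₁, ιψ₂` orthonormal in `H`,
`κ₁⁻¹ + κ₂⁻¹ ≤ (‖ψ₁‖² + ‖Gψ₁‖²) + (‖ψ₂‖² + ‖Gψ₂‖²)`. [cite: ReedSimonIV1978, Thm. XIII.1–2] -/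
theorem kyFan_two_le_of_graph {ψ₁ ψ₂ : Q} (h₁ : ‖ι ψ₁‖ = 1) (h₂ : ‖ι ψ₂‖ = 1) (h₁₂ : ⟪ι ψ₁, ι ψ₂⟫_𝕜 = 0) :
    d.κ₁⁻¹ + d.κ₂⁻¹ ≤ (‖ψ₁‖ ^ 2 + ‖G ψ₁‖ ^ 2) + (‖ψ₂‖ ^ 2 + ‖G ψ₂‖ ^ 2) := by
  rw [← norm_toGraph_sq, ← norm_toGraph_sq]
  exact d.kyFan_two_le (by simpa using h₁) (by simpa using h₂) (by simpa using h₁₂)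

/-- **The lowest eigenvalue of the perturbed form over a form core of `q`**: for every dense subspace
`S ⊆ Q` and `ε > 0` there is `ψ ∈ S` with `‖ιψ‖ = 1` and `‖ψ‖² + ‖Gψ‖² < κ₁⁻¹ + ε`.
[cite: Kato1966, Thm. VI.1.33] -/
theorem exists_lt_of_dense_of_graph {S : Submodule 𝕜 Q} (hS : Dense (S : Set Q)) {ε : ℝ} (hε : 0 < ε) :
    ∃ ψ ∈ S, ‖ι ψ‖ = 1 ∧ ‖ψ‖ ^ 2 + ‖G ψ‖ ^ 2 < d.κ₁⁻¹ + ε := by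
  obtain ⟨y, hyS, hy1, hlt⟩ := d.exists_lt_of_dense (dense_map_toGraph G hS) hε
  obtain ⟨x, hxS, rfl⟩ := exists_eq_toGraph_of_mem_map G hyS
  refine ⟨x, hxS, by simpa using hy1, ?_⟩
  rwa [norm_toGraph_sq] at hlt

/-- **Ky Fan over a form core of `q` for the perturbed form**: for every dense subspace `S ⊆ Q` and
`ε > 0` there are `ψ₁, ψ₂ ∈ S` with `ιψ₁, ιψ₂` orthonormal and
`(‖ψ₁‖² + ‖Gψ₁‖²) + (‖ψ₂‖² + ‖Gψ₂‖²) < κ₁⁻¹ + κ₂⁻¹ + ε`. [cite: Kato1966, Thm. VI.1.33] -/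
theorem exists_pair_lt_of_dense_of_graph {S : Submodule 𝕜 Q} (hS : Dense (S : Set Q)) {ε : ℝ} (hε : 0 < ε) :
    ∃ ψ₁ ∈ S, ∃ ψ₂ ∈ S, ‖ι ψ₁‖ = 1 ∧ ‖ι ψ₂‖ = 1 ∧ ⟪ι ψ₁, ι ψ₂⟫_𝕜 = 0 ∧
      (‖ψ₁‖ ^ 2 + ‖G ψ₁‖ ^ 2) + (‖ψ₂‖ ^ 2 + ‖G ψ₂‖ ^ 2) < d.κ₁⁻¹ + d.κ₂⁻¹ + ε := by
  obtain ⟨y₁, hy₁S, y₂, hy₂S, h₁, h₂, h₁₂, hlt⟩ := d.exists_pair_lt_of_dense (dense_map_toGraph G hS) hε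
  obtain ⟨x₁, hx₁S, rfl⟩ := exists_eq_toGraph_of_mem_map G hy₁S
  obtain ⟨x₂, hx₂S, rfl⟩ := exists_eq_toGraph_of_mem_map G hy₂S
  refine ⟨x₁, hx₁S, x₂, hx₂S, by simpa using h₁, by simpa using h₂, by simpa using h₁₂, ?_⟩
  rwa [norm_toGraph_sq, norm_toGraph_sq] at hlt

/-- **Eigenvectors of the perturbed Gram operator, read on `Q`**: if `gramOp (graphEmbedding ι G) u = κ u`
then, with `ψ = u.1`, `‖ιψ‖² = κ (‖ψ‖² + ‖Gψ‖²)`. [folklore] -/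
theorem norm_map_fst_sq_of_gramOp_eq {u : graphSpace G} {κ : ℝ}
    (hu : gramOp (graphEmbedding ι G) u = (κ : 𝕜) • u) :
    ‖ι ((u : WithLp 2 (Q × H')).fst)‖ ^ 2 =
      κ * (‖(u : WithLp 2 (Q × H')).fst‖ ^ 2 + ‖G (u : WithLp 2 (Q × H')).fst‖ ^ 2) := by
  rw [← norm_sq_eq_of_mem_graphSpace, ← graphEmbedding_apply]
  exact norm_map_sq_of_gramOp_eq_smul _ hu

end TwoModeData

end Literature.Analysis.InnerProduct

end
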